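import Summits.BirchSwinnertonDyer.BirchSwinnertonDyer.Theorems.EisensteinPrimesBSDpOnCellCTelescopeBranchMemberFrames
import Summits.BirchSwinnertonDyer.BirchSwinnertonDyer.Theorems.EisensteinPrimesBSDpOnCellCTelescopeBranchWilesRepAlgebra
import Summits.BirchSwinnertonDyer.BirchSwinnertonDyer.Theorems.EisensteinPrimesBSDpOnCellCTelescopeBranchCoefficientDescent
import Summits.BirchSwinnertonDyer.BirchSwinnertonDyer.Theorems.EisensteinPrimesBSDpOnCellCTelescopeBranchTraceInterpolation
import Summits.BirchSwinnertonDyer.BirchSwinnertonDyer.Theorems.EisensteinPrimesBSDpOnCellCTelescopeBranchTateFrameRational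
import Summits.BirchSwinnertonDyer.BirchSwinnertonDyer.Theorems.EisensteinPrimesBSDpOnCellCTelescopeBranchGaloisLatticeOfUntwistedFact
import Summits.BirchSwinnertonDyer.BirchSwinnertonDyer.Theorems.EisensteinPrimesBSDpOnCellCTelescopeChartDistinctFibres
import Literature.NumberTheory.GaloisRepresentations.WilesPseudoRepresentationGluing
import Literature.NumberTheory.GaloisRepresentations.WilesPseudoRepresentationAdaptedBasis
import Literature.NumberTheory.GaloisRepresentations.FrobeniusDensity
import Literature.NumberTheory.Automorphic.ChebotarevArtinRepHolds
import Literature.RepresentationTheory.Semisimple.SubrepresentationEquiv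
import HarnessLib

/-!
# [telescope — width x2-p2 g25, 2026-08-30] Brick G2 (instantiation) + G2c of «(F) CONSTRUCTED IN TREE»: the GLUED Wiles
pseudo-representation over `ℤ_p⟦X⟧` on the analytic chart, non-degenerate, with its fibre identities

Crux 4 `BSDpOnCellC` (stmt-BirchSwinnertonDyer-19034), line «telescope» v19; ʳ-chain (director (610); host map STATUS l.7169 / l.7197 (b);
LEAD g7 `RCHAIN-SPEC-g7.md` §1–§4). INPUT: a chart `IsPNewBranchAnalyticChart W p ι j A x D` with `ℚ_p`-rational members ((F-rat)), `p ∥ N` odd.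
OUTPUT (`exists_gluedPseudoRep`): a complex conjugation `c ∈ Γ_ℚ`, a Wiles pseudo-representation `Ψ` of `(Γ_ℚ, c)` over `Λ = ℤ_p⟦X⟧`
(B3 `WilesPseudoRep.ofTraceFamily` over the jointly injective family `{constantCoeff} ∪ {evalHom (x t)}`, glued from the tree's Tate frame
(g43 p776189) and the members' Deligne representations over `ℤ_p` (#3 `TelescopeBranchMemberFrames`) put in Wiles position by B4′
`exists_of_rep`; the trace `T` by the LEAD's G1 `exists_continuous_interpolant_with_zero_fibre` from the chart's `A_ℓ` descended by G0
`exists_map_eq_and_evalHom`, Frobenii dense by `absoluteGaloisGroup.frobenius_dense chebotarev_artinRep_holds`), with: continuous `a, d, x`;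
NON-DEGENERACY `Ψ.x r₀ s₀ ≠ 0` (G2c: the `X = 0` fibre `T_pE ⊗ ℚ_p` is irreducible — #1 `exists_offDiag_mul_ne_zero_of_isIrreducible` through
`isIrreducible_conjRep`); the trace INERTIA-INVARIANT off `N`; and the fibre characteristic polynomials `X² − tr·X + det` at `X = 0` / `X = x_t`
equal to `X² − a_ℓ(E)X + ℓ` / `X² − ι_t(a_ℓ(g_t))X + ℓ^{k_t−1}` at arithmetic Frobenii — exactly what G3/G5 turn into (F-unr)/(F-fib₀)/(F-fib_t).

Helper toward crux 4 (`--supports`); closes NO registered stub, proves no cited fact and no summit statement; BSD is proved for no curve.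
-/

noncomputable section

set_option autoImplicit false
set_option linter.dupNamespace false

open scoped MatrixGroups ModularForm NumberField PowerSeries.WithPiTopology Topology
open NumberField IsDedekindDomain Field CongruenceSubgroup Matrix UpperHalfPlane Filter PowerSeries
  Literature.NumberTheory.GaloisRepresentations
  Literature.NumberTheory.EllipticCurves
  Literature.NumberTheory.EllipticCurves.ModularForms
  Literature.NumberTheory.EllipticCurves.GreenbergSelmer
  Literature.RepresentationTheory.Semisimple

namespace Summit.BirchSwinnertonDyer.BirchSwinnertonDyer.Theorems.TelescopeBranchGluedPseudoRep

variable {p : ℕ} [Fact p.Prime]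

/-! ### §1. Small inputs: `2 ∈ ℤ_pˣ`, parity, irreducibility of a conjugate -/

/-- For an odd prime `p`, `2` is a unit of `ℤ_p`. [folklore] -/
theorem isUnit_two (hp : 2 < p) : IsUnit (2 : ℤ_[p]) := by
  rw [PadicInt.isUnit_iff]
  have h1 : ‖((2 : ℤ) : ℤ_[p])‖ ≤ 1 := PadicInt.norm_le_one _
  have h2 : ¬ ‖((2 : ℤ) : ℤ_[p])‖ < 1 := by
    rw [PadicInt.norm_int_lt_one_iff_dvd]
    intro h
    have : (p : ℤ) ≤ 2 := Int.le_of_dvd (by norm_num) h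
    omega
  push_cast at h1 h2
  exact le_antisymm h1 (not_lt.mp h2)

/-- `2(p−1) ∣ k − 2` and `2 < k` make `k − 1` an odd natural number. [folklore] -/
theorem odd_toNat_sub_one {k : ℤ} (hk : 2 < k) (hdvd : 2 * ((p : ℤ) - 1) ∣ k - 2) : Odd (k - 1).toNat := by
  obtain ⟨e, he⟩ := hdvd
  refine ⟨(((p : ℤ) - 1) * e).toNat, ?_⟩
  have hp1 : (1 : ℤ) ≤ (p : ℤ) - 1 := by have := (Fact.out : p.Prime).two_le; omega
  have he' : k - 2 = 2 * (((p : ℤ) - 1) * e) := by rw [he]; ring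
  have hpos : 0 ≤ ((p : ℤ) - 1) * e := by nlinarith
  omega

/-- Conjugating a matrix representation by a unit does not affect irreducibility of the representation on `K²` it defines.
[folklore] -/
theorem isIrreducible_conjRep {K : Type*} [Field K] {G : Type*} [Group G] (ρ : G →* Matrix (Fin 2) (Fin 2) K)
    (U : (Matrix (Fin 2) (Fin 2) K)ˣ) (σρ σ' : Representation K G (Fin 2 → K)) (hσρ : ∀ g v, σρ g v = ρ g *ᵥ v)
    (hσ' : ∀ g v, σ' g v = WilesPseudoRep.conjRep ρ U g *ᵥ v) (hirr : σρ.IsIrreducible) : σ'.IsIrreducible := by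
  let f : (Fin 2 → K) →ₗ[K] (Fin 2 → K) := Matrix.toLin' (↑U⁻¹ : Matrix (Fin 2) (Fin 2) K)
  have hf : ∀ g v, f (σρ g v) = σ' g (f v) := by
    intro g v
    rw [hσρ, hσ', Matrix.toLin'_apply, Matrix.toLin'_apply, WilesPseudoRep.conjRep_apply, Matrix.mulVec_mulVec,
      Matrix.mulVec_mulVec, Matrix.mul_assoc, Units.mul_inv, Matrix.mul_one]
  have hbij : Function.Bijective f := by
    have h1 : Function.LeftInverse (Matrix.toLin' (U : Matrix (Fin 2) (Fin 2) K)) f := fun v => by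
      change Matrix.toLin' (U : Matrix (Fin 2) (Fin 2) K) (Matrix.toLin' (↑U⁻¹ : Matrix (Fin 2) (Fin 2) K) v) = v
      rw [Matrix.toLin'_apply, Matrix.toLin'_apply, Matrix.mulVec_mulVec, Units.mul_inv, Matrix.one_mulVec]
    have h2 : Function.RightInverse (Matrix.toLin' (U : Matrix (Fin 2) (Fin 2) K)) f := fun v => by
      change Matrix.toLin' (↑U⁻¹ : Matrix (Fin 2) (Fin 2) K) (Matrix.toLin' (U : Matrix (Fin 2) (Fin 2) K) v) = v
      rw [Matrix.toLin'_apply, Matrix.toLin'_apply, Matrix.mulVec_mulVec, Units.inv_mul, Matrix.one_mulVec]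
    exact ⟨h1.injective, h2.surjective⟩
  haveI := hirr
  exact Representation.isIrreducible_of_equiv ((f.intertwiningMap_of_isIntertwiningMap σρ σ' hf).ofBijective hbij)

/-! ### §2. The glued pseudo-representation on the chart -/

/-- **The glued Wiles pseudo-representation on the analytic chart (RCHAIN-SPEC §1–§4).** For `W/ℚ` globally minimal, `p` odd of
multiplicative reduction, an analytic chart `IsPNewBranchAnalyticChart W p ι j A x D` with `ℚ_p`-rational members, there are a complex
conjugation `c ∈ Γ_ℚ`, a Wiles pseudo-representation `Ψ` of `(Γ_ℚ, c)` over `ℤ_p⟦X⟧` with continuous `a`, `d`, `x(r₀,·)`, `x(·,s₀)` and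
`x(r₀,s₀) ≠ 0`, whose trace is invariant under every inertia group at `v ∤ N`, and whose fibre polynomials `X² − tr·X + det` at `X = 0` and
at `X = x_t` are, at every arithmetic Frobenius above `ℓ ∤ Np`, `X² − a_ℓ(E)X + ℓ` and (read in `ℚ̄_p`) `X² − ι_t(a_ℓ(g_t))X + ℓ^{k_t−1}`.
[cite: Wiles1988, §2.2 (the Λ-adic pseudo-representation by interpolation)] [cite: Hida2000, Lemma 3.28, §2.2.1, Prop. 2.16]
[cite: Hida1986, Thm. 2.1 (2.2b) (2.2c), §2 (2.1b)] -/
theorem exists_gluedPseudoRep (W : WeierstrassCurve ℚ) [W.IsElliptic] [W.IsGloballyMinimal] (hp : 2 < p)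
    (hmult : W.HasMultiplicativeReductionAtPrime p) {ι : PadicAlgCl p ≃+* ℂ} {j : ℤ_[p] →+* unrIntegers p}
    (hj : ∀ z : ℤ_[p], ((j z : unrIntegers p) : ℂ_[p]) = algebraMap ℚ_[p] ℂ_[p] (z : ℚ_[p]))
    {A : ℕ → UnrSeries p} {x : ℕ → ℤ_[p]} {D : ℕ → Skinner2016.HidaCongruentForm W p 1}
    (hchart : IsPNewBranchAnalyticChart W p ι j A x D)
    (hrat : ∀ t : ℕ, Function.Surjective (algebraMap ℤ_[p] (padicCoeffIntegers (D t).ι))) :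
    ∃ (c : absoluteGaloisGroup ℚ) (Ψ : WilesPseudoRep (absoluteGaloisGroup ℚ) (PowerSeries ℤ_[p]) c)
      (r₀ s₀ : absoluteGaloisGroup ℚ),
      Ψ.x r₀ s₀ ≠ 0 ∧ Continuous Ψ.a ∧ Continuous Ψ.d ∧ (Continuous fun g => Ψ.x r₀ g) ∧ (Continuous fun g => Ψ.x g s₀) ∧
      (∀ v : HeightOneSpectrum (𝓞 ℚ), ¬ ((Rat.HeightOneSpectrum.primesEquiv v : Nat.Primes) : ℕ) ∣ W.conductorNorm ℤ →
        ∀ 𝔓 ∈ v.primesAbove, ∀ σ ∈ 𝔓.inertia (absoluteGaloisGroup ℚ), ∀ g, Ψ.tr (g * σ) = Ψ.tr g) ∧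
      (∀ v : HeightOneSpectrum (𝓞 ℚ), ¬ ((Rat.HeightOneSpectrum.primesEquiv v : Nat.Primes) : ℕ) ∣ W.conductorNorm ℤ →
        ((Rat.HeightOneSpectrum.primesEquiv v : Nat.Primes) : ℕ) ≠ p →
        ∀ 𝔓 ∈ v.primesAbove, ∀ σ : absoluteGaloisGroup ℚ, IsArithFrobAt (𝓞 ℚ) σ 𝔓 →
          Polynomial.X ^ 2 - Polynomial.C (constantCoeff (Ψ.tr σ)) * Polynomial.X + Polynomial.C (constantCoeff (Ψ.det σ)) =
            Polynomial.X ^ 2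
              - Polynomial.C (((W.frobeniusTrace ((Rat.HeightOneSpectrum.primesEquiv v : Nat.Primes) : ℕ) : ℤ) : ℤ_[p])) *
                  Polynomial.X
              + Polynomial.C ((((Rat.HeightOneSpectrum.primesEquiv v : Nat.Primes) : ℕ) : ℤ_[p]))) ∧
      (∀ (t : ℕ) (ht : ‖x t‖ < 1), ∀ v : HeightOneSpectrum (𝓞 ℚ),
        ¬ ((Rat.HeightOneSpectrum.primesEquiv v : Nat.Primes) : ℕ) ∣ W.conductorNorm ℤ →
        ((Rat.HeightOneSpectrum.primesEquiv v : Nat.Primes) : ℕ) ≠ p →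
        ∀ 𝔓 ∈ v.primesAbove, ∀ σ : absoluteGaloisGroup ℚ, IsArithFrobAt (𝓞 ℚ) σ 𝔓 →
          (Polynomial.X ^ 2 - Polynomial.C (evalHom (x t) ht (Ψ.tr σ)) * Polynomial.X +
              Polynomial.C (evalHom (x t) ht (Ψ.det σ))).map ((algebraMap ℚ_[p] (PadicAlgCl p)).comp PadicInt.Coe.ringHom) =
            Polynomial.X ^ 2
              - Polynomial.C ((D t).ι ⟨(qExpansion 1 ⇑(D t).g).coeff ((Rat.HeightOneSpectrum.primesEquiv v : Nat.Primes) : ℕ),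
                  coeff_mem_coeffField (D t).g _⟩) * Polynomial.X
              + Polynomial.C ((((Rat.HeightOneSpectrum.primesEquiv v : Nat.Primes) : ℕ) : PadicAlgCl p) ^ ((D t).k - 1).toNat)) := by
  classical
  have hN0 : W.conductorNorm ℤ ≠ 0 := (W.conductorNorm_pos_holds).ne'
  have hpN : p ∣ W.conductorNorm ℤ :=
    TelescopeBranchGaloisLatticeOfUntwistedFact.dvd_conductorNorm_of_hasMultiplicativeReductionAtPrime W p hmult
  -- chart data
  have hx : ∀ t, ‖x t‖ < 1 := hchart.norm_lt_one
  have hx0 : Tendsto x atTop (𝓝 0) := hchart.tendsto_zero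
  have hxne : ∀ t, x t ≠ 0 := TelescopeChartDistinctFibres.chart_x_ne_zero hchart
  -- `2⁻¹ ∈ Λ`
  have h2 : IsUnit (2 : ℤ_[p]) := isUnit_two hp
  obtain ⟨w, hw⟩ := h2
  have hu : (2 : PowerSeries ℤ_[p]) * PowerSeries.C (↑w⁻¹ : ℤ_[p]) = 1 := by
    rw [show (2 : PowerSeries ℤ_[p]) = PowerSeries.C (2 : ℤ_[p]) from (map_ofNat _ 2).symm, ← map_mul, ← hw, Units.mul_inv,
      map_one]
  -- members over `ℤ_p` (#3) and the zero fibre (the Tate frame)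
  choose ρt hρt hρtv using fun t => TelescopeBranchMemberFrames.exists_padicInt_frame (D t).Δ (hrat t)
  haveI : Module.Free ℤ_[p] (W.tateModule p) := WeierstrassCurve.module_free_tateModule_holds W p
  haveI : Module.Finite ℤ_[p] (W.tateModule p) := WeierstrassCurve.module_finite_tateModule_holds W p
  have hpQ : (p : ℚ) ≠ 0 := Nat.cast_ne_zero.mpr (Fact.out : p.Prime).ne_zero
  have hrank : Module.finrank ℤ_[p] (W.tateModule p) = 2 :=
    WeierstrassCurve.finrank_tateModule_eq_two_of_card_torsionPoints_eq_sq W p (WeierstrassCurve.card_torsionPoints_eq_sq_holds W _) hpQ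
  let b : Module.Basis (Fin 2) ℤ_[p] (W.tateModule p) := Module.finBasisOfFinrankEq ℤ_[p] (W.tateModule p) hrank
  haveI : IsModuleTopology ℤ_[p] (W.tateModule p) := TateModule.isModuleTopology
  set τ₀ : FramedGaloisRep ℚ ℤ_[p] 2 := (WeierstrassCurve.tateGaloisRep W p (W.continuous_galoisRepTate_holds p)).frame b with hτ₀def
  have hτ₀ := fun v hv => TelescopeBranchTateFrameRational.isUnramifiedAt_and_hasFrobCharpolyAt_tateFrame W hpN b v hv
  have hirr0 := TelescopeBranchTateFrameRational.isIrreducible_baseChange_tateFrame_of_hasMultiplicativeReductionAtPrime W hmult b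
  -- a complex conjugation; oddness of all fibres
  obtain ⟨c, hc⟩ := exists_isComplexConjugation (Rat.castHom ℝ)
  have hcc : c * c = 1 := by rw [← pow_two]; exact hc.sq_eq_one
  have hdet0 : ((τ₀ c : GL (Fin 2) ℤ_[p]) : Matrix (Fin 2) (Fin 2) ℤ_[p]).det = -1 := by
    refine TelescopeBranchMemberFrames.det_eq_neg_one_of_isComplexConjugation τ₀ hN0 hpN 1 odd_one (fun v hv 𝔓 h𝔓 σ hσ => ?_) hc
    have h := (hτ₀ v hv).2 𝔓 h𝔓 σ hσ
    change ((τ₀ σ : GL (Fin 2) ℤ_[p]) : Matrix (Fin 2) (Fin 2) ℤ_[p]).charpoly = _ at h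
    rw [Matrix.det_eq_sign_charpoly_coeff, h, Fintype.card_fin]
    simp
  have hdett : ∀ t, ((ρt t c : GL (Fin 2) ℤ_[p]) : Matrix (Fin 2) (Fin 2) ℤ_[p]).det = -1 := fun t =>
    TelescopeBranchMemberFrames.det_eq_neg_one_of_isComplexConjugation (ρt t) hN0 hpN _
      (odd_toNat_sub_one (D t).two_lt_k (hchart.dvd_weight_sub_two t))
      (fun v hv 𝔓 h𝔓 σ hσ => ((hρtv t v (TelescopeBranchUntwistedOfFrobenius.not_dvd_div_and_ne hpN hv).1
        (TelescopeBranchUntwistedOfFrobenius.not_dvd_div_and_ne hpN hv).2).2 𝔓 h𝔓 σ hσ).2.2) hc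
  -- the fibres in Wiles position (B4′)
  set M0 : absoluteGaloisGroup ℚ →* Matrix (Fin 2) (Fin 2) ℤ_[p] := (Units.coeHom _).comp τ₀.toMonoidHom with hM0def
  set Mt : ℕ → (absoluteGaloisGroup ℚ →* Matrix (Fin 2) (Fin 2) ℤ_[p]) := fun t => (Units.coeHom _).comp (ρt t).toMonoidHom
    with hMtdef
  have hM0 : ∀ g, M0 g = ((τ₀ g : GL (Fin 2) ℤ_[p]) : Matrix (Fin 2) (Fin 2) ℤ_[p]) := fun g => rfl
  have hMt : ∀ t g, Mt t g = ((ρt t g : GL (Fin 2) ℤ_[p]) : Matrix (Fin 2) (Fin 2) ℤ_[p]) := fun t g => rfl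
  have h2' : IsUnit (2 : ℤ_[p]) := isUnit_two hp
  obtain ⟨U0, hU0, htr0, hdt0⟩ := WilesPseudoRep.exists_of_rep h2' hcc M0 hdet0
  choose Ut hUt htrt hdtt using fun t => WilesPseudoRep.exists_of_rep h2' hcc (Mt t) (hdett t)
  -- the jointly injective fibre family `{constantCoeff} ∪ {evalHom (x t)}`
  let φ : Option ℕ → (PowerSeries ℤ_[p] →+* ℤ_[p]) := fun i => i.elim (constantCoeff (R := ℤ_[p])) fun t => evalHom (x t) (hx t)
  let πfam : Option ℕ → WilesPseudoRep (absoluteGaloisGroup ℚ) ℤ_[p] c :=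
    fun i => i.elim (WilesPseudoRep.ofRep (WilesPseudoRep.conjRep M0 U0) hU0)
      fun t => WilesPseudoRep.ofRep (WilesPseudoRep.conjRep (Mt t) (Ut t)) (hUt t)
  have hφ : ∀ v w : PowerSeries ℤ_[p], (∀ i, φ i v = φ i w) → v = w := fun v w h =>
    TelescopeBranchTraceInterpolation.eq_of_forall_evalHom_eq x hx hx0 hxne v w fun t => h (some t)
  -- traces and their interpolants (G0, G1)
  set S : Set (HeightOneSpectrum (𝓞 ℚ)) :=
    {v | ((Rat.HeightOneSpectrum.primesEquiv v : Nat.Primes) : ℕ) ∣ W.conductorNorm ℤ} with hSdef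
  have hSfin : S.Finite := TelescopeBranchMemberFrames.finite_setOf_primesEquiv_dvd hN0
  have hD : Dense {σ : absoluteGaloisGroup ℚ | ∃ v ∉ S, ∃ 𝔓 ∈ v.primesAbove, IsArithFrobAt (𝓞 ℚ) σ 𝔓} :=
    absoluteGaloisGroup.frobenius_dense Literature.NumberTheory.Automorphic.chebotarev_artinRep_holds ℚ S hSfin
  let τ : ℕ → absoluteGaloisGroup ℚ → ℤ_[p] := fun t σ => (Mt t σ).trace
  let τinf : absoluteGaloisGroup ℚ → ℤ_[p] := fun σ => (M0 σ).trace
  have hτc : ∀ t, Continuous (τ t) := fun t => FramedRep.continuous_trace (ρt t)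
  have hτinfc : Continuous τinf := FramedRep.continuous_trace τ₀
  -- on a Frobenius `d` at `𝔓 ∣ ℓ`, `ℓ ∤ N`: the chart's `A_ℓ` descends and interpolates the traces
  have key : ∀ d ∈ {σ : absoluteGaloisGroup ℚ | ∃ v ∉ S, ∃ 𝔓 ∈ v.primesAbove, IsArithFrobAt (𝓞 ℚ) σ 𝔓},
      ∃ F : PowerSeries ℤ_[p], (∀ t, evalHom (x t) (hx t) F = τ t d) ∧ constantCoeff F = τinf d := by
    rintro d ⟨v, hvS, 𝔓, h𝔓, hd⟩
    rw [hSdef, Set.mem_setOf_eq] at hvS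
    set ℓ : ℕ := ((Rat.HeightOneSpectrum.primesEquiv v : Nat.Primes) : ℕ) with hℓdef
    have hℓ : ℓ.Prime := (Rat.HeightOneSpectrum.primesEquiv v).2
    obtain ⟨hℓM, hℓp⟩ := TelescopeBranchUntwistedOfFrobenius.not_dvd_div_and_ne hpN hvS
    obtain ⟨⟨U₀, hA0⟩, hAt⟩ := hchart.chart hℓ hvS
    -- `j (τ_t d) = c_t` for every remainder constant `c_t` of `A_ℓ` at `x_t`
    have hjτ : ∀ (t : ℕ) (c' : unrIntegers p) (U : UnrSeries p),
        A ℓ = PowerSeries.C c' + (PowerSeries.X - PowerSeries.C (j (x t))) * U →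
        (((c' : unrIntegers p) : ℂ_[p]) = algebraMap (PadicAlgCl p) ℂ_[p]
          ((D t).ι ⟨(qExpansion 1 ⇑(D t).g).coeff ℓ, coeff_mem_coeffField (D t).g ℓ⟩)) → j (τ t d) = c' := by
      intro t c' U _ hc'
      have htr : algebraMap ℚ_[p] (PadicAlgCl p) ((τ t d : ℤ_[p]) : ℚ_[p]) =
          (D t).ι ⟨(qExpansion 1 ⇑(D t).g).coeff ℓ, coeff_mem_coeffField (D t).g ℓ⟩ := ((hρtv t v hℓM hℓp).2 𝔓 h𝔓 d hd).2.1
      have e1 : ((j (τ t d) : unrIntegers p) : ℂ_[p]) =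
          algebraMap (PadicAlgCl p) ℂ_[p] (algebraMap ℚ_[p] (PadicAlgCl p) ((τ t d : ℤ_[p]) : ℚ_[p])) := by
        rw [hj, ← IsScalarTower.algebraMap_apply]
      exact Subtype.ext (e1.trans ((congrArg (algebraMap (PadicAlgCl p) ℂ_[p]) htr).trans hc'.symm))
    obtain ⟨F, hFmap, hFval⟩ := TelescopeBranchCoefficientDescent.exists_map_eq_and_evalHom j hj x hx hx0 hxne (A ℓ)
      (fun t => by
        obtain ⟨c', U, hAeq, hc'⟩ := hAt t
        exact ⟨c', U, ⟨τ t d, hjτ t c' U hAeq hc'⟩, hAeq⟩)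
    refine ⟨F, fun t => ?_, ?_⟩
    · obtain ⟨c', U, hAeq, hc'⟩ := hAt t
      exact TelescopeBranchCoefficientDescent.eq_of_j_eq j hj ((hFval t c' U hAeq).trans (hjτ t c' U hAeq hc').symm)
    · have h0 := TelescopeBranchCoefficientDescent.constantCoeff_eq_of_map_eq j hj F (hFmap.trans hA0)
      rw [h0]
      -- `tr τ₀(d) = a_ℓ(E)` from the Frobenius characteristic polynomial of the Tate frame
      have h := (hτ₀ v hvS).2 𝔓 h𝔓 d hd
      change (M0 d).charpoly = _ at h
      change _ = (M0 d).trace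
      rw [Matrix.trace_eq_neg_charpoly_coeff, h, Fintype.card_fin]
      simp [hℓdef]
  have hint : ∀ d ∈ {σ : absoluteGaloisGroup ℚ | ∃ v ∉ S, ∃ 𝔓 ∈ v.primesAbove, IsArithFrobAt (𝓞 ℚ) σ 𝔓},
      ∃ F : PowerSeries ℤ_[p], ∀ t, evalHom (x t) (hx t) F = τ t d := fun d hd => by
    obtain ⟨F, hF, -⟩ := key d hd
    exact ⟨F, hF⟩
  have hDinf : ∀ d ∈ {σ : absoluteGaloisGroup ℚ | ∃ v ∉ S, ∃ 𝔓 ∈ v.primesAbove, IsArithFrobAt (𝓞 ℚ) σ 𝔓},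
      Tendsto (fun t => τ t d) atTop (𝓝 (τinf d)) := fun d hd => by
    obtain ⟨F, hF, hF0⟩ := key d hd
    have h := TelescopeBranchTraceInterpolation.tendsto_evalHom_constantCoeff F x hx hx0
    rw [hF0] at h
    exact h.congr fun t => hF t
  obtain ⟨T, hTc, hTt, hT0, -⟩ := TelescopeBranchTraceInterpolation.exists_continuous_interpolant_with_zero_fibre hD x hx hx0 hxne
    τ hτc τinf hτinfc hint hDinf
  -- glue (B3)
  have hTfam : ∀ i r, (πfam i).tr r = φ i (T r) := by
    rintro (_ | t) r
    · change (WilesPseudoRep.ofRep (WilesPseudoRep.conjRep M0 U0) hU0).tr r = constantCoeff (T r)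
      rw [htr0, hT0]
    · change (WilesPseudoRep.ofRep (WilesPseudoRep.conjRep (Mt t) (Ut t)) (hUt t)).tr r = evalHom (x t) (hx t) (T r)
      rw [htrt, hTt]
  let Ψ : WilesPseudoRep (absoluteGaloisGroup ℚ) (PowerSeries ℤ_[p]) c :=
    WilesPseudoRep.ofTraceFamily φ hφ T (PowerSeries.C (↑w⁻¹ : ℤ_[p])) hu πfam hTfam
  have hΨtr : ∀ r, Ψ.tr r = T r := WilesPseudoRep.tr_ofTraceFamily φ hφ T _ hu πfam hTfam
  have hΨdet : ∀ i r, φ i (Ψ.det r) = (πfam i).det r := WilesPseudoRep.map_det_ofTraceFamily φ hφ T _ hu πfam hTfam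
  have hΨx : ∀ i r s, φ i (Ψ.x r s) = (πfam i).x r s := fun i r s => by
    have := congrArg (fun π : WilesPseudoRep (absoluteGaloisGroup ℚ) ℤ_[p] c => π.x r s)
      (WilesPseudoRep.ofTraceFamily_map φ hφ T _ hu πfam hTfam i)
    exact this
  -- non-degeneracy (G2c) at the `X = 0` fibre
  set coe : ℤ_[p] →+* ℚ_[p] := PadicInt.Coe.ringHom with hcoedef
  let ρ' : absoluteGaloisGroup ℚ →* Matrix (Fin 2) (Fin 2) ℚ_[p] := (RingHom.mapMatrix coe).toMonoidHom.comp M0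
  let U' : (Matrix (Fin 2) (Fin 2) ℚ_[p])ˣ := Units.map (RingHom.mapMatrix coe).toMonoidHom U0
  have hconj' : ∀ g, WilesPseudoRep.conjRep ρ' U' g = (WilesPseudoRep.conjRep M0 U0 g).map coe := by
    intro g
    rw [WilesPseudoRep.conjRep_apply, WilesPseudoRep.conjRep_apply, Matrix.map_mul, Matrix.map_mul]
    have h1 : ((U'⁻¹ : (Matrix (Fin 2) (Fin 2) ℚ_[p])ˣ) : Matrix (Fin 2) (Fin 2) ℚ_[p]) =
        ((U0⁻¹ : (Matrix (Fin 2) (Fin 2) ℤ_[p])ˣ) : Matrix (Fin 2) (Fin 2) ℤ_[p]).map coe := Units.coe_map_inv _ _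
    have h2 : ((U' : (Matrix (Fin 2) (Fin 2) ℚ_[p])ˣ) : Matrix (Fin 2) (Fin 2) ℚ_[p]) =
        ((U0 : (Matrix (Fin 2) (Fin 2) ℤ_[p])ˣ) : Matrix (Fin 2) (Fin 2) ℤ_[p]).map coe := Units.coe_map _ _
    rw [h1, h2]
    rfl
  let σ' : Representation ℚ_[p] (absoluteGaloisGroup ℚ) (Fin 2 → ℚ_[p]) :=
    { toFun := fun g => Matrix.toLin' (WilesPseudoRep.conjRep ρ' U' g)
      map_one' := by rw [map_one, Matrix.toLin'_one]; rfl
      map_mul' := fun g h => by rw [map_mul, Matrix.toLin'_mul]; rfl }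
  have hirr' : σ'.IsIrreducible := by
    refine isIrreducible_conjRep ρ' U' _ σ' (fun g v => ?_) (fun g v => Matrix.toLin'_apply _ _) hirr0
    rw [FramedRep.toRepresentation_apply_apply, FramedRep.coe_baseChange_apply]
    rfl
  obtain ⟨r₀, s₀, hne⟩ := TelescopeBranchWilesRepAlgebra.exists_offDiag_mul_ne_zero_of_isIrreducible σ' (WilesPseudoRep.conjRep ρ' U')
    (fun g v => Matrix.toLin'_apply _ _) hirr'
  have hx₀ : Ψ.x r₀ s₀ ≠ 0 := by
    intro h0
    apply hne
    have h1 : constantCoeff (Ψ.x r₀ s₀) = WilesPseudoRep.conjRep M0 U0 r₀ 0 1 * WilesPseudoRep.conjRep M0 U0 s₀ 1 0 := hΨx none r₀ s₀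
    rw [h0, map_zero] at h1
    rw [hconj', hconj', Matrix.map_apply, Matrix.map_apply, ← map_mul, ← h1, map_zero]
  refine ⟨c, Ψ, r₀, s₀, hx₀,
    WilesPseudoRep.continuous_ofTraceFamily_a φ hφ _ hu πfam hTfam hTc,
    WilesPseudoRep.continuous_ofTraceFamily_d φ hφ _ hu πfam hTfam hTc,
    WilesPseudoRep.continuous_ofTraceFamily_x_left φ hφ _ hu πfam hTfam hTc r₀,
    WilesPseudoRep.continuous_ofTraceFamily_x_right φ hφ _ hu πfam hTfam hTc s₀, ?_, ?_, ?_⟩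
  · -- the trace is inertia-invariant off `N` (fibrewise unramified, then the identity principle)
    intro v hv 𝔓 h𝔓 σ hσ g
    rw [hΨtr, hΨtr]
    refine TelescopeBranchTraceInterpolation.eq_of_forall_evalHom_eq x hx hx0 hxne _ _ fun t => ?_
    rw [hTt, hTt]
    obtain ⟨hℓM, hℓp⟩ := TelescopeBranchUntwistedOfFrobenius.not_dvd_div_and_ne hpN hv
    have h1 : ρt t σ = 1 := (hρtv t v hℓM hℓp).1 𝔓 h𝔓 σ hσ
    change (Mt t (g * σ)).trace = (Mt t g).trace
    rw [map_mul, hMt t σ, h1, Units.val_one, mul_one]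
  · -- the `X = 0` fibre polynomial
    intro v hv hvp 𝔓 h𝔓 σ hσ
    have htr : constantCoeff (Ψ.tr σ) = (M0 σ).trace := by rw [hΨtr, hT0]
    have hdet : constantCoeff (Ψ.det σ) = (M0 σ).det := by rw [← hdt0 σ]; exact hΨdet none σ
    have h := (hτ₀ v hv).2 𝔓 h𝔓 σ hσ
    change (M0 σ).charpoly = _ at h
    rw [htr, hdet, ← Matrix.charpoly_fin_two, h]
  · -- the `X = x_t` fibre polynomial
    intro t ht v hv hvp 𝔓 h𝔓 σ hσ
    obtain ⟨hℓM, hℓp⟩ := TelescopeBranchUntwistedOfFrobenius.not_dvd_div_and_ne hpN hv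
    have hev : evalHom (x t) ht = φ (some t) := rfl
    have htr : evalHom (x t) ht (Ψ.tr σ) = (Mt t σ).trace := by rw [hev, hΨtr]; exact hTt σ t
    have hdet : evalHom (x t) ht (Ψ.det σ) = (Mt t σ).det := by rw [hev, hΨdet (some t) σ]; exact hdtt t σ
    rw [htr, hdet, ← Matrix.charpoly_fin_two, hMt]
    exact ((hρtv t v hℓM hℓp).2 𝔓 h𝔓 σ hσ).1

end Summit.BirchSwinnertonDyer.BirchSwinnertonDyer.Theorems.TelescopeBranchGluedPseudoRep

end
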